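import Mathlib
import HarnessLib
import Summits.AtomisticToContinuum.Crystallization.Theorems.PricedLinkCensusSoftFourRingsCapEndgameReduction
import Summits.AtomisticToContinuum.Crystallization.Theorems.PricedLinkCensusSoftFourRingsCapCertD8Check
import Summits.AtomisticToContinuum.Crystallization.Theorems.PricedLinkCensusSoftFourRingsRigMain

/-!
# Soft four-rings: `SoftFourRings` holds

Route `PricedLinkCensus`, sub-problem `Crystallization`, item `SoftFourRings`
(stmt-AtomisticToContinuum-14234).  Assembly of the three unconditional pieces:

* `Cap.softFourRings_of_labelledRigidity : BondToCap → δ ≤ 6/25 → LabelledRigidity δ → SoftFourRings`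
  (the `Cap` variant of the soft-four-rings chain: reduction to twelve unit directions, hull
  combinatorics, the labelled cuboctahedral / anticuboctahedral bond graph — all from the LOCAL
  covering property of the directions instead of Tammes-13);
* `Rig.labelledRigidity_holds : LabelledRigidity (6/25)` (certified numerics, seat c1);
* `Cap.bondToCap_holds : BondToCap` (kernel-checked pole-centred semidefinite certificate, seat c3).
-/

namespace Summit.AtomisticToContinuum.Crystallization.Theorems

/-- **The effective soft link theorem `SoftFourRings`** (Flatley–Theil Prop. 3.3 in ring form at
tolerance one percent, matching radius `nn_i/4`): for every `η ∈ (0, 1/100]` and every site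
charge-free at `η`, a rotated and scaled fcc or hcp kissing pattern about the site has every pattern
point within `nn_i/4` of a site.  Unconditional. -/
theorem softFourRings_holds :
    Summit.AtomisticToContinuum.Crystallization.Theses.PricedLinkCensus.SoftFourRings :=
  Cap.softFourRings_of_labelledRigidity Cap.bondToCap_holds le_rfl Rig.labelledRigidity_holds

end Summit.AtomisticToContinuum.Crystallization.Theorems
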